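import Literature.MathematicalPhysics.KineticTheory.HardSphereEuler
import Literature.Analysis.FunctionSpaces.TorusSpaceTime
import HarnessLib

/-!
# EnskogAdjointDuality / AdjointEnskogTestFamilyR — Maxwellian characteristic derivative,
# part 3: torus calculus of the Euler densities and fluxes

Support lemmas for the stub `stub_maxwellianCharDeriv` (B2) of the line `birth` of the crux
`Summit.AtomisticToContinuum.HydrodynamicLimit.Theses.EnskogAdjointDuality.AdjointEnskogTestFamilyR`
(stmt-AtomisticToContinuum-11592). The representative-free operators `Torus.partialDeriv`,
`Torus.gradient`, `Torus.divergence` of `TorusCalculus` carry junk values on non-differentiable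
functions, so their linearity needs `C¹` hypotheses; this file records the instances used to
split the Euler fluxes:

* `k2r_hasDerivAt_partialDeriv` — `t ↦ f(x + t eᵢ)` has derivative `∂ᵢf(x)` at `0`;
* `k2r_partialDeriv_add/sub/const_mul/inner_const` — linearity of `∂ᵢ`;
* `k2r_inner_gradient`, `k2r_inner_gradient_sub` — `⟪b, ∇g⟫ = ∑ᵢ bᵢ ∂ᵢg` and its linearity;
* `k2r_divergence_smul`, `k2r_divergence_sub_smul` — `div(a u) = ∑ᵢ ∂ᵢ(a uᵢ)` expanded, and
  `div(a u) − div(a' u) = div((a − a') u)`;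
* `k2r_isSmoothSpaceTimeOn_energy`, `k2r_isSmooth_pressure` — the Euler energy density is jointly
  smooth, and the hard-sphere pressure `ρθ Z(ρσ³)` is smooth in space on the packing window
  (`Z = 1 + η f_ex'` with `f_ex` analytic there);
* `k2r_sum_partialDeriv_flux` — the divergence of the fluxes of the hydrodynamic moments:
  `∑ᵢ ∂ᵢ[ρ(uᵢ m_ψ + θ(bᵢ + γuᵢ))] = c₁ div(ρu) + ⟪b, ∑ᵢ∂ᵢ(ρuᵢu)⟫ + ⟪b, ∇(ρθ)⟫ + γ div((E+ρθ)u)`.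

References: L. C. Evans, *Partial Differential Equations* (2010), App. C.2 [Evans2010];
C. Cercignani, R. Illner, M. Pulvirenti, *The Mathematical Theory of Dilute Gases* (1994), §3.3
[CIP1994].
-/

noncomputable section

open Set Filter Topology
open scoped InnerProductSpace BigOperators ContDiff

namespace Summit.AtomisticToContinuum.HydrodynamicLimit.Theorems.EnskogAdjointDuality

open Literature.MathematicalPhysics.KineticTheory Literature.Analysis.FunctionSpaces
  Literature.Analysis.FluidPDE

variable {F : Type*} [NormedAddCommGroup F] [NormedSpace ℝ F]

/-- `t ↦ f(x + t eᵢ)` has derivative `∂ᵢ f(x)` at `t = 0` for `C¹` `f` on the torus. [folklore] -/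
theorem k2r_hasDerivAt_partialDeriv {f : T3 → F} (hf : Torus.IsContDiff 1 f) (i : Fin 3) (x : T3) :
    HasDerivAt (fun t : ℝ => f (x + Torus.proj (t • EuclideanSpace.single i (1 : ℝ))))
      (Torus.partialDeriv i f x) 0 := by
  have h := Torus.hasDerivAt_comp_add_proj_smul hf x (EuclideanSpace.single i (1 : ℝ)) 0
  simp only [zero_smul, Torus.proj_zero, add_zero] at h
  exact h

/-- Additivity of `∂ᵢ` on `C¹` functions. [folklore] -/
theorem k2r_partialDeriv_add {f g : T3 → F} (hf : Torus.IsContDiff 1 f) (hg : Torus.IsContDiff 1 g)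
    (i : Fin 3) (x : T3) :
    Torus.partialDeriv i (fun y => f y + g y) x = Torus.partialDeriv i f x + Torus.partialDeriv i g x :=
  ((k2r_hasDerivAt_partialDeriv hf i x).add (k2r_hasDerivAt_partialDeriv hg i x)).deriv

/-- `∂ᵢ` of a difference of `C¹` functions. [folklore] -/
theorem k2r_partialDeriv_sub {f g : T3 → F} (hf : Torus.IsContDiff 1 f) (hg : Torus.IsContDiff 1 g)
    (i : Fin 3) (x : T3) :
    Torus.partialDeriv i (fun y => f y - g y) x = Torus.partialDeriv i f x - Torus.partialDeriv i g x :=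
  ((k2r_hasDerivAt_partialDeriv hf i x).sub (k2r_hasDerivAt_partialDeriv hg i x)).deriv

/-- `∂ᵢ` commutes with constant factors on `C¹` functions. [folklore] -/
theorem k2r_partialDeriv_const_mul {f : T3 → ℝ} (hf : Torus.IsContDiff 1 f) (c : ℝ) (i : Fin 3)
    (x : T3) :
    Torus.partialDeriv i (fun y => c * f y) x = c * Torus.partialDeriv i f x :=
  ((k2r_hasDerivAt_partialDeriv hf i x).const_mul c).deriv

/-- `∂ᵢ` commutes with the inner product against a constant vector on `C¹` functions. [folklore] -/
theorem k2r_partialDeriv_inner_const {G : Type*} [NormedAddCommGroup G] [InnerProductSpace ℝ G]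
    {f : T3 → G} (hf : Torus.IsContDiff 1 f) (b : G) (i : Fin 3) (x : T3) :
    Torus.partialDeriv i (fun y => ⟪b, f y⟫_ℝ) x = ⟪b, Torus.partialDeriv i f x⟫_ℝ := by
  have h := ((hasDerivAt_const (0 : ℝ) b).inner ℝ (k2r_hasDerivAt_partialDeriv hf i x)).deriv
  rw [inner_zero_left, add_zero] at h
  exact h

/-- The gradient in coordinates against a vector: `⟪b, ∇g(x)⟫ = ∑ᵢ bᵢ ∂ᵢg(x)` for `C¹` `g`.
[folklore] -/
theorem k2r_inner_gradient {g : T3 → ℝ} (hg : Torus.IsContDiff 1 g) (b : V3) (x : T3) :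
    ⟪b, Torus.gradient g x⟫_ℝ = ∑ i, b i * Torus.partialDeriv i g x := by
  rw [real_inner_comm, Torus.inner_gradient_left, Torus.fderiv_apply_eq_sum_partialDeriv hg]
  simp [smul_eq_mul]

/-- Linearity of the gradient (tested against a vector) on `C¹` functions:
`⟪b, ∇(f − g)⟫ = ⟪b, ∇f⟫ − ⟪b, ∇g⟫`. [folklore] -/
theorem k2r_inner_gradient_sub {f g : T3 → ℝ} (hf : Torus.IsContDiff 1 f) (hg : Torus.IsContDiff 1 g)
    (b : V3) (x : T3) :
    ⟪b, Torus.gradient (fun y => f y - g y) x⟫_ℝ =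
      ⟪b, Torus.gradient f x⟫_ℝ - ⟪b, Torus.gradient g x⟫_ℝ := by
  have hfg : Torus.IsContDiff 1 (fun y => f y - g y) := ContDiff.sub hf hg
  rw [k2r_inner_gradient hfg, k2r_inner_gradient hf, k2r_inner_gradient hg, ← Finset.sum_sub_distrib]
  refine Finset.sum_congr rfl fun i _ => ?_
  rw [k2r_partialDeriv_sub hf hg, mul_sub]

/-- The divergence of `a u` in coordinates: `div(a u)(x) = ∑ᵢ ∂ᵢ(a uᵢ)(x)` (unfolding). [folklore] -/
theorem k2r_divergence_smul (a : T3 → ℝ) (u : T3 → V3) (x : T3) :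
    Torus.divergence (fun y => a y • u y) x = ∑ i, Torus.partialDeriv i (fun y => a y * u y i) x :=
  rfl

/-- Linearity of the divergence in the scalar weight on `C¹` functions:
`div(a u) − div(a' u) = div((a − a') u)`. [folklore] -/
theorem k2r_divergence_sub_smul {a a' : T3 → ℝ} {u : T3 → V3} (ha : Torus.IsContDiff 1 a)
    (ha' : Torus.IsContDiff 1 a') (hu : Torus.IsContDiff 1 u) (x : T3) :
    Torus.divergence (fun y => a y • u y) x - Torus.divergence (fun y => a' y • u y) x =
      Torus.divergence (fun y => (a y - a' y) • u y) x := by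
  simp only [k2r_divergence_smul, ← Finset.sum_sub_distrib]
  refine Finset.sum_congr rfl fun i _ => ?_
  have hui : Torus.IsContDiff 1 (fun y => u y i) := (EuclideanSpace.proj i : V3 →L[ℝ] ℝ).contDiff.comp hu
  have h1 : Torus.IsContDiff 1 (fun y => a y * u y i) := ContDiff.mul ha hui
  have h2 : Torus.IsContDiff 1 (fun y => a' y * u y i) := ContDiff.mul ha' hui
  rw [← k2r_partialDeriv_sub h1 h2]
  congr 1
  funext y
  ring

/-- The total energy density of jointly smooth fields is jointly smooth. [folklore] -/
theorem k2r_isSmoothSpaceTimeOn_energy {S : Set ℝ} {ρ θ : ℝ → T3 → ℝ} {u : ℝ → T3 → V3}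
    (hρ : Torus.IsSmoothSpaceTimeOn S ρ) (hu : Torus.IsSmoothSpaceTimeOn S u)
    (hθ : Torus.IsSmoothSpaceTimeOn S θ) :
    Torus.IsSmoothSpaceTimeOn S (fun r y => totalEnergyDensity (ρ r y) (u r y) (θ r y)) := by
  unfold Torus.IsSmoothSpaceTimeOn at *
  have h : Torus.stLift (fun r y => totalEnergyDensity (ρ r y) (u r y) (θ r y)) =
      fun p => Torus.stLift ρ p * (‖Torus.stLift u p‖ ^ 2 / 2 + 3 / 2 * Torus.stLift θ p) := by
    funext p; rfl
  rw [h]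
  exact hρ.mul (((hu.norm_sq ℝ).div_const 2).add (contDiffOn_const.mul hθ))

/-- **Smoothness of the hard-sphere pressure in space on the packing window.** If `f_ex` is
analytic on `(0, η₁)`, `ρ₀, θ₀` are smooth on `𝕋³` and `0 < ρ₀σ³ < η₁` everywhere, then
`y ↦ hsPressure σ (ρ₀ y) (θ₀ y) = ρ₀θ₀ (1 + ρ₀σ³ f_ex'(ρ₀σ³))` is smooth. [folklore] -/
theorem k2r_isSmooth_pressure {η₁ σ : ℝ} (hA : AnalyticOnNhd ℝ hsExcessFreeEnergy (Ioo 0 η₁))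
    {ρ₀ θ₀ : T3 → ℝ} (hρ : Torus.IsSmooth ρ₀) (hθ : Torus.IsSmooth θ₀)
    (hwin : ∀ y, ρ₀ y * σ ^ 3 ∈ Ioo 0 η₁) :
    Torus.IsSmooth (fun y => hsPressure σ (ρ₀ y) (θ₀ y)) := by
  have hZ : ContDiffOn ℝ ∞ hsCompressibility (Ioo 0 η₁) := by
    have hd : ContDiffOn ℝ ∞ (deriv hsExcessFreeEnergy) (Ioo 0 η₁) :=
      hA.deriv.contDiffOn_of_completeSpace
    have h : hsCompressibility = fun η => 1 + η * deriv hsExcessFreeEnergy η := by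
      funext η; rfl
    rw [h]
    exact contDiffOn_const.add (contDiffOn_id.mul hd)
  have hlift : Torus.lift (fun y => hsPressure σ (ρ₀ y) (θ₀ y)) =
      fun z => Torus.lift ρ₀ z * Torus.lift θ₀ z *
        (hsCompressibility ∘ fun z => Torus.lift ρ₀ z * σ ^ 3) z := by
    funext z; rfl
  unfold Torus.IsSmooth
  rw [hlift]
  refine (ContDiff.mul hρ hθ).mul (hZ.comp_contDiff (ContDiff.mul hρ contDiff_const) fun z => ?_)
  exact hwin _

/-! ## The fluxes -/

/-- **Divergence of the fluxes.** For `C¹` fields on the torus,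
`∑ᵢ ∂ᵢ[ρ (uᵢ m_ψ + θ (bᵢ + γuᵢ))] = c₁ div(ρu) + ⟪b, ∑ᵢ ∂ᵢ(ρuᵢ u)⟫ + ⟪b, ∇(ρθ)⟫ + γ div((E + ρθ)u)`,
`m_ψ = c₁ + ⟪b,u⟫ + γ(|u|²/2 + 3θ/2)`, `E = ρ(|u|²/2 + 3θ/2)`. [cite: CIP1994, §3.3] -/
theorem k2r_sum_partialDeriv_flux {ρ₀ θ₀ : T3 → ℝ} {u₀ : T3 → V3} (hρ : Torus.IsContDiff 1 ρ₀)
    (hθ : Torus.IsContDiff 1 θ₀) (hu : Torus.IsContDiff 1 u₀) (x : T3) (c₁ γ : ℝ) (b : V3) :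
    ∑ i, Torus.partialDeriv i (fun y => ρ₀ y * (u₀ y i * (c₁ + ⟪b, u₀ y⟫_ℝ +
        γ * (‖u₀ y‖ ^ 2 / 2 + 3 * θ₀ y / 2)) + θ₀ y * (b i + γ * u₀ y i))) x =
      c₁ * Torus.divergence (fun y => ρ₀ y • u₀ y) x +
        ⟪b, ∑ i, Torus.partialDeriv i (fun y => (ρ₀ y * u₀ y i) • u₀ y) x⟫_ℝ +
        ⟪b, Torus.gradient (fun y => ρ₀ y * θ₀ y) x⟫_ℝ +
        γ * Torus.divergence
          (fun y => (totalEnergyDensity (ρ₀ y) (u₀ y) (θ₀ y) + ρ₀ y * θ₀ y) • u₀ y) x := by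
  have hui : ∀ i, Torus.IsContDiff 1 (fun y => u₀ y i) :=
    fun i => (EuclideanSpace.proj i : V3 →L[ℝ] ℝ).contDiff.comp hu
  have hA : ∀ i, Torus.IsContDiff 1 (fun y => ρ₀ y * u₀ y i) := fun i => ContDiff.mul hρ (hui i)
  have hBv : ∀ i, Torus.IsContDiff 1 (fun y => (ρ₀ y * u₀ y i) • u₀ y) :=
    fun i => ContDiff.smul (hA i) hu
  have hB : ∀ i, Torus.IsContDiff 1 (fun y => ⟪b, (ρ₀ y * u₀ y i) • u₀ y⟫_ℝ) :=
    fun i => ContDiff.inner ℝ contDiff_const (hBv i)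
  have hC : Torus.IsContDiff 1 (fun y => ρ₀ y * θ₀ y) := ContDiff.mul hρ hθ
  have hEf : Torus.IsContDiff 1 (fun y => totalEnergyDensity (ρ₀ y) (u₀ y) (θ₀ y) + ρ₀ y * θ₀ y) := by
    unfold Torus.IsContDiff totalEnergyDensity
    exact ContDiff.add (ContDiff.mul hρ (((ContDiff.norm_sq ℝ hu).div_const 2).add
      (contDiff_const.mul hθ))) hC
  have hD : ∀ i, Torus.IsContDiff 1
      (fun y => (totalEnergyDensity (ρ₀ y) (u₀ y) (θ₀ y) + ρ₀ y * θ₀ y) * u₀ y i) :=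
    fun i => ContDiff.mul hEf (hui i)
  -- rewrite each flux as a sum of four `C¹` pieces and differentiate
  have hterm : ∀ i, Torus.partialDeriv i (fun y => ρ₀ y * (u₀ y i * (c₁ + ⟪b, u₀ y⟫_ℝ +
      γ * (‖u₀ y‖ ^ 2 / 2 + 3 * θ₀ y / 2)) + θ₀ y * (b i + γ * u₀ y i))) x =
      c₁ * Torus.partialDeriv i (fun y => ρ₀ y * u₀ y i) x +
        ⟪b, Torus.partialDeriv i (fun y => (ρ₀ y * u₀ y i) • u₀ y) x⟫_ℝ +
        b i * Torus.partialDeriv i (fun y => ρ₀ y * θ₀ y) x +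
        γ * Torus.partialDeriv i
          (fun y => (totalEnergyDensity (ρ₀ y) (u₀ y) (θ₀ y) + ρ₀ y * θ₀ y) * u₀ y i) x := by
    intro i
    have hfun : (fun y => ρ₀ y * (u₀ y i * (c₁ + ⟪b, u₀ y⟫_ℝ +
        γ * (‖u₀ y‖ ^ 2 / 2 + 3 * θ₀ y / 2)) + θ₀ y * (b i + γ * u₀ y i))) =
        fun y => c₁ * (ρ₀ y * u₀ y i) + ⟪b, (ρ₀ y * u₀ y i) • u₀ y⟫_ℝ + b i * (ρ₀ y * θ₀ y) +
          γ * ((totalEnergyDensity (ρ₀ y) (u₀ y) (θ₀ y) + ρ₀ y * θ₀ y) * u₀ y i) := by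
      funext y
      simp only [totalEnergyDensity, inner_smul_right]
      ring
    have h1 : Torus.IsContDiff 1 (fun y => c₁ * (ρ₀ y * u₀ y i)) := ContDiff.mul contDiff_const (hA i)
    have h3 : Torus.IsContDiff 1 (fun y => b i * (ρ₀ y * θ₀ y)) := ContDiff.mul contDiff_const hC
    have h4 : Torus.IsContDiff 1 (fun y => γ * ((totalEnergyDensity (ρ₀ y) (u₀ y) (θ₀ y) +
        ρ₀ y * θ₀ y) * u₀ y i)) := ContDiff.mul contDiff_const (hD i)
    have h12 : Torus.IsContDiff 1 (fun y => c₁ * (ρ₀ y * u₀ y i) + ⟪b, (ρ₀ y * u₀ y i) • u₀ y⟫_ℝ) :=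
      ContDiff.add h1 (hB i)
    have h123 : Torus.IsContDiff 1 (fun y => c₁ * (ρ₀ y * u₀ y i) + ⟪b, (ρ₀ y * u₀ y i) • u₀ y⟫_ℝ +
        b i * (ρ₀ y * θ₀ y)) := ContDiff.add h12 h3
    rw [hfun, k2r_partialDeriv_add h123 h4, k2r_partialDeriv_add h12 h3, k2r_partialDeriv_add h1 (hB i),
      k2r_partialDeriv_const_mul (hA i), k2r_partialDeriv_inner_const (hBv i),
      k2r_partialDeriv_const_mul hC, k2r_partialDeriv_const_mul (hD i)]
  simp_rw [hterm, Finset.sum_add_distrib, ← Finset.mul_sum, ← inner_sum, k2r_inner_gradient hC b x,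
    k2r_divergence_smul]

/-- **Registered form (sub-goal `stub_maxwellianCharDeriv_flux` of stub B2).** Divergence of the
fluxes of the hydrodynamic moments on the torus:
`∑ᵢ ∂ᵢ[ρ(uᵢ m_ψ + θ(bᵢ + γuᵢ))] = c₁ div(ρu) + ⟪b, ∑ᵢ∂ᵢ(ρuᵢu)⟫ + ⟪b, ∇(ρθ)⟫ + γ div((E+ρθ)u)`.
[cite: CIP1994, §3.3] -/
theorem stub_maxwellianCharDeriv_flux :
    ∀ (ρ₀ θ₀ : UnitAddTorus (Fin 3) → ℝ) (u₀ : UnitAddTorus (Fin 3) → EuclideanSpace ℝ (Fin 3)),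
    Literature.Analysis.FunctionSpaces.Torus.IsContDiff 1 ρ₀ →
    Literature.Analysis.FunctionSpaces.Torus.IsContDiff 1 θ₀ →
    Literature.Analysis.FunctionSpaces.Torus.IsContDiff 1 u₀ →
    ∀ (x : UnitAddTorus (Fin 3)) (c₁ γ : ℝ) (b : EuclideanSpace ℝ (Fin 3)),
    ∑ i, Literature.Analysis.FunctionSpaces.Torus.partialDeriv i (fun y => ρ₀ y * (u₀ y i *
        (c₁ + inner ℝ b (u₀ y) + γ * (‖u₀ y‖ ^ 2 / 2 + 3 * θ₀ y / 2)) + θ₀ y * (b i + γ * u₀ y i))) x =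
      c₁ * Literature.Analysis.FunctionSpaces.Torus.divergence (fun y => ρ₀ y • u₀ y) x +
        inner ℝ b (∑ i, Literature.Analysis.FunctionSpaces.Torus.partialDeriv i
          (fun y => (ρ₀ y * u₀ y i) • u₀ y) x) +
        inner ℝ b (Literature.Analysis.FunctionSpaces.Torus.gradient (fun y => ρ₀ y * θ₀ y) x) +
        γ * Literature.Analysis.FunctionSpaces.Torus.divergence (fun y =>
          (Literature.MathematicalPhysics.KineticTheory.totalEnergyDensity (ρ₀ y) (u₀ y) (θ₀ y) +
            ρ₀ y * θ₀ y) • u₀ y) x :=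
  fun _ _ _ hρ hθ hu x c₁ γ b => k2r_sum_partialDeriv_flux hρ hθ hu x c₁ γ b

end Summit.AtomisticToContinuum.HydrodynamicLimit.Theorems.EnskogAdjointDuality

end
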